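import Literature.MathematicalPhysics.QuantumFieldTheory.Balaban1983to89.B6VecIMSV1
import HarnessLib

/-!
# Route `UnitScaleTilt`, crux K1 «MinimiserStabilityRegPr» (stmt-QuantumFields-19200), route-R E′ S3 ∕ line «HKGK-ANALYTIC», row (R-loc) brick 1 —
# THE FLAT CACCIOPPOLI INEQUALITY WITH AN ARBITRARY CUTOFF ON THE TORUS `T^{(j)}`, SOURCED FORM, in `LatticeFieldCalculus` letters (`laplace 1`, `Site P j`):
# `Σ_μΣ_x (χ(x)² + χ(x+e_μ)²)(u(x+e_μ) − u(x))² ≤ 4·Σ_x χ(x)²u(x)(Δu)(x) + 2·Σ_μΣ_x (χ(x+e_μ) − χ(x))²(u(x) + u(x+e_μ))²`, and with `Δu = f` on `{χ ≠ 0}`: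
# `… ≤ 2t·Σ χ²f² + (2∕t)·Σ χ²u² + 2·Σ(∂χ)²(u+u₊)²` for every `t > 0` (★ym-ust-19200-w4 g7 LOCATE v2 §3 (R-loc); this seat's LOCATE-RLOC, 2026-08-29)

Cell `ym3-torus`, twin-width seat `ym-ust-19936-w8` (gen 5).  THEOREMS ONLY (0 `def`, 0 `sorry`); `--supports stmt-QuantumFields-19200 --as helper`, count-neutral.  YM₃ on T³ is a
ladder rung (R3), not the Clay problem; nothing here claims S3, hKg-K, ℛ-ROW★, E′, the stub, the crux, d = 4 or the mass gap.

WHY.  The ℛ-line's flat core (✓p676293 → ✓p680640 → ✓p681767 → ✓p683722) is GLOBAL on the torus; the curved rows must be proved by LOCALISATION at a scale `ℓ ≪ R ≪ ℓ∕√e`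
(LOCATE v2 item 2: no global near-flat gauge exists in large volume).  (R-loc) = a LOCAL flat Bernstein inequality `Σ_Ω|∇u|² ≤ C·ℓ⁻²·Σ_{Ω⁺}u²` for local solutions of `Δu = (Q_k)ᵀν`.
Its two bricks: (1) THIS FILE — Caccioppoli with an arbitrary real cutoff `χ` and the source kept (`4Σχ²u·Δu`), plus the Young split at scale `t = ℓ²` — the sibling, on the
`Site P j` carrier and WITH source, of ✓`N07PlateCaccioppoli.caccioppoli_lap` (carrier `TorusSite`), ✓`B4Eq19LatticeCaccioppoli.caccioppoli` (`ℤ^d` boxes, divergence-form source) and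
✓`Prop7CovPuncturedCaccioppoli.sum_sq_mul_hs_covD_le` (covariant, harmonic on `{ψ ≠ 0}` only); (2) the BLOCKWISE inverse estimate `Σ_B f² ≤ C·ℓ⁻⁴·Σ_B u²` for tent-structured `f`
(interior `C¹` bumps; LOCATE-RLOC §2) — not here.

WHAT IS PROVED (ns `…Theorems.Prop7FlatCutoffCaccioppoli`; any `P : Params`, level `j`, real `χ u f : SiteField P j ℝ`; differences written out, `laplace 1` of `LatticeFieldCalculus`).
* §1 `two_mul_sq_mul_laplace_eq` — testing `Δu` against `χ²u` with the symmetric Leibniz split: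
  `2·Σ_x χ²u·Δu = Σ_μΣ_x [(χ² + χ₊²)(u₊ − u)² + (χ₊² − χ²)(u + u₊)(u₊ − u)]` (✓`B6VecIMSV1.sum_mul_laplace_eq_sum_pdiff`).
* §2 ★★ `caccioppoli_cutoff` — `Σ_μΣ_x (χ² + χ₊²)(u₊ − u)² ≤ 4·Σ_x χ²u·Δu + 2·Σ_μΣ_x (χ₊ − χ)²(u + u₊)²` (sum-of-squares absorption);
  ★ `caccioppoli_cutoff_of_laplace_eq_zero` — harmonic on `{χ ≠ 0}`: `… ≤ 2·Σ(∂χ)²(u+u₊)²`.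
* §3 ★★★ `caccioppoli_cutoff_sourced` — `Δu = f` on `{χ ≠ 0}`, any `t > 0`: `Σ_μΣ_x (χ² + χ₊²)(u₊ − u)² ≤ 2t·Σ_x χ²f² + (2∕t)·Σ_x χ²u² + 2·Σ_μΣ_x (χ₊ − χ)²(u + u₊)²`;
  ★ `sum_sq_mul_sq_diff_le_sourced` — the consumer's left side `Σ_μΣ_x χ(x)²(u(x+e_μ) − u(x))²` alone (drop `χ₊²`).
HONEST SCOPE.  [folklore] (Caccioppoli 1951; [Giaquinta1984] Ch. III §2), flat, linear, real scalar; the blockwise inverse estimate and the (R-loc) assembly are separate files;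
nothing of Bałaban's is asserted.

References: M. Giaquinta, Princeton UP 1983 [Giaquinta1984] (Ch. III §2 (2.3)–(2.4) p.77); T. Bałaban, CMP 95 (1984) 17–40 [Balaban1984PropagatorsI] ((1.21) p.21);
CMP 96 (1984) 223–250 [Balaban1984PropagatorsII] ((1.9) p.226).
-/

set_option autoImplicit false

noncomputable section

open scoped BigOperators

namespace Summit.QuantumFields.YangMills.Theorems.Prop7FlatCutoffCaccioppoli

open Literature.MathematicalPhysics.QuantumFieldTheory.Balaban1983to89
open Finset LatticeFieldCalculus
open B6VecIMSV1 (sum_mul_laplace_eq_sum_pdiff)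

variable {P : Params} {j : ℕ}

/-! ## §1 Testing `Δu` against `χ²u` -/

/-- **THE TESTED IDENTITY WITH THE SYMMETRIC SPLIT**: `2·Σ_x χ(x)²u(x)(Δu)(x) = Σ_μΣ_x [(χ(x)² + χ(x+e_μ)²)(u(x+e_μ) − u(x))² + (χ(x+e_μ)² − χ(x)²)(u(x) + u(x+e_μ))(u(x+e_μ) − u(x))]`
(`Σ g·Δf = Σ_μΣ ∂_μg·∂_μf` with `g = χ²u`, and `2(χ₊²u₊ − χ²u) = (χ² + χ₊²)(u₊ − u) + (χ₊² − χ²)(u + u₊)`). [cite: Balaban1984PropagatorsI, (1.21) p.21] -/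
theorem two_mul_sq_mul_laplace_eq (χ u : SiteField P j ℝ) :
    2 * ∑ x : Site P j, χ x ^ 2 * u x * laplace 1 u x =
      ∑ μ : Fin P.d, ∑ x : Site P j, ((χ x ^ 2 + χ (x.shift μ) ^ 2) * (u (x.shift μ) - u x) ^ 2 +
        (χ (x.shift μ) ^ 2 - χ x ^ 2) * (u x + u (x.shift μ)) * (u (x.shift μ) - u x)) := by
  have h := sum_mul_laplace_eq_sum_pdiff (P := P) (j := j) 1 (fun x => χ x ^ 2 * u x) u
  have h' : ∑ x : Site P j, χ x ^ 2 * u x * laplace 1 u x = ∑ x : Site P j, (fun x => χ x ^ 2 * u x) x * laplace 1 u x := rfl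
  rw [h', h, Finset.mul_sum]
  refine Finset.sum_congr rfl fun μ _ => ?_
  rw [Finset.mul_sum]
  refine Finset.sum_congr rfl fun x _ => ?_
  simp only [pdiff, smul_eq_mul, one_mul]
  ring

/-! ## §2 The Caccioppoli inequality with an arbitrary cutoff -/

/-- ★★ **CACCIOPPOLI WITH CUTOFF, SOURCE KEPT**: for all real `χ, u` on the torus,
`Σ_μΣ_x (χ(x)² + χ(x+e_μ)²)(u(x+e_μ) − u(x))² ≤ 4·Σ_x χ(x)²u(x)(Δu)(x) + 2·Σ_μΣ_x (χ(x+e_μ) − χ(x))²(u(x) + u(x+e_μ))²` — §1 and the pointwise sum of squares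
`(a² + b²)δ² + 2(b² − a²)Uδ + 2(b − a)²U² = ½((a + b)δ + 2(b − a)U)² + ½(a − b)²δ² ≥ 0`. [cite: Giaquinta1984, Ch. III §2 (2.3)-(2.4) p.77; Balaban1984PropagatorsII, (1.9) p.226] -/
theorem caccioppoli_cutoff (χ u : SiteField P j ℝ) :
    ∑ μ : Fin P.d, ∑ x : Site P j, (χ x ^ 2 + χ (x.shift μ) ^ 2) * (u (x.shift μ) - u x) ^ 2
      ≤ 4 * ∑ x : Site P j, χ x ^ 2 * u x * laplace 1 u x
        + 2 * ∑ μ : Fin P.d, ∑ x : Site P j, (χ (x.shift μ) - χ x) ^ 2 * (u x + u (x.shift μ)) ^ 2 := by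
  have h2 := two_mul_sq_mul_laplace_eq χ u
  -- the summed pointwise sum of squares
  have hsos : 0 ≤ ∑ μ : Fin P.d, ∑ x : Site P j, ((χ x ^ 2 + χ (x.shift μ) ^ 2) * (u (x.shift μ) - u x) ^ 2
      + 2 * ((χ (x.shift μ) ^ 2 - χ x ^ 2) * (u x + u (x.shift μ)) * (u (x.shift μ) - u x))
      + 2 * ((χ (x.shift μ) - χ x) ^ 2 * (u x + u (x.shift μ)) ^ 2)) := by
    refine Finset.sum_nonneg fun μ _ => Finset.sum_nonneg fun x _ => ?_
    nlinarith [sq_nonneg ((χ x + χ (x.shift μ)) * (u (x.shift μ) - u x) + 2 * (χ (x.shift μ) - χ x) * (u x + u (x.shift μ))),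
      sq_nonneg ((χ x - χ (x.shift μ)) * (u (x.shift μ) - u x))]
  have e1 : ∑ μ : Fin P.d, ∑ x : Site P j, ((χ x ^ 2 + χ (x.shift μ) ^ 2) * (u (x.shift μ) - u x) ^ 2
      + 2 * ((χ (x.shift μ) ^ 2 - χ x ^ 2) * (u x + u (x.shift μ)) * (u (x.shift μ) - u x))
      + 2 * ((χ (x.shift μ) - χ x) ^ 2 * (u x + u (x.shift μ)) ^ 2))
      = 2 * (∑ μ : Fin P.d, ∑ x : Site P j, ((χ x ^ 2 + χ (x.shift μ) ^ 2) * (u (x.shift μ) - u x) ^ 2 +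
          (χ (x.shift μ) ^ 2 - χ x ^ 2) * (u x + u (x.shift μ)) * (u (x.shift μ) - u x)))
        - ∑ μ : Fin P.d, ∑ x : Site P j, (χ x ^ 2 + χ (x.shift μ) ^ 2) * (u (x.shift μ) - u x) ^ 2
        + 2 * ∑ μ : Fin P.d, ∑ x : Site P j, (χ (x.shift μ) - χ x) ^ 2 * (u x + u (x.shift μ)) ^ 2 := by
    simp only [Finset.mul_sum, ← Finset.sum_sub_distrib, ← Finset.sum_add_distrib]
    refine Finset.sum_congr rfl fun μ _ => Finset.sum_congr rfl fun x _ => by ring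
  rw [e1, ← h2] at hsos
  linarith

/-- ★ **HARMONIC ON THE SUPPORT OF THE CUTOFF**: if `(Δu)(x) = 0` whenever `χ(x) ≠ 0`, then `Σ_μΣ_x (χ² + χ₊²)(u₊ − u)² ≤ 2·Σ_μΣ_x (χ₊ − χ)²(u + u₊)²`.
[cite: Giaquinta1984, Ch. III §2 (2.3)-(2.4) p.77] -/
theorem caccioppoli_cutoff_of_laplace_eq_zero (χ u : SiteField P j ℝ) (h : ∀ x : Site P j, χ x ≠ 0 → laplace 1 u x = 0) :
    ∑ μ : Fin P.d, ∑ x : Site P j, (χ x ^ 2 + χ (x.shift μ) ^ 2) * (u (x.shift μ) - u x) ^ 2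
      ≤ 2 * ∑ μ : Fin P.d, ∑ x : Site P j, (χ (x.shift μ) - χ x) ^ 2 * (u x + u (x.shift μ)) ^ 2 := by
  have h0 : ∑ x : Site P j, χ x ^ 2 * u x * laplace 1 u x = 0 := by
    refine Finset.sum_eq_zero fun x _ => ?_
    by_cases hx : χ x = 0
    · rw [hx]; ring
    · rw [h x hx, mul_zero]
  have hc := caccioppoli_cutoff χ u
  rw [h0, mul_zero, zero_add] at hc
  exact hc

/-! ## §3 The sourced form at scale `t` -/

/-- ★★★ **CACCIOPPOLI WITH CUTOFF, SOURCED, AT SCALE `t`**: if `(Δu)(x) = f(x)` whenever `χ(x) ≠ 0`, then for every `t > 0`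
`Σ_μΣ_x (χ(x)² + χ(x+e_μ)²)(u(x+e_μ) − u(x))² ≤ 2t·Σ_x χ(x)²f(x)² + (2∕t)·Σ_x χ(x)²u(x)² + 2·Σ_μΣ_x (χ(x+e_μ) − χ(x))²(u(x) + u(x+e_μ))²`
(§2 and Young `4χ²uf ≤ 2t·χ²f² + (2∕t)·χ²u²`).  READING for (R-loc) (`t := ℓ²`, `χ` a block-Lipschitz cutoff `|∂χ| ≤ ℓ⁻¹`): the gradient energy under the cutoff is `≲ ℓ²·(source mass) + ℓ⁻²·(mass)`,
and the blockwise inverse estimate `Σ_B f² ≲ ℓ⁻⁴Σ_B u²` (separate file) makes both terms `ℓ⁻²·(mass)`. [cite: Giaquinta1984, Ch. III §2 (2.3)-(2.4) p.77; Balaban1984PropagatorsII, (1.9) p.226] -/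
theorem caccioppoli_cutoff_sourced (χ u f : SiteField P j ℝ) (hΔ : ∀ x : Site P j, χ x ≠ 0 → laplace 1 u x = f x) {t : ℝ} (ht : 0 < t) :
    ∑ μ : Fin P.d, ∑ x : Site P j, (χ x ^ 2 + χ (x.shift μ) ^ 2) * (u (x.shift μ) - u x) ^ 2
      ≤ 2 * t * ∑ x : Site P j, χ x ^ 2 * f x ^ 2 + 2 / t * ∑ x : Site P j, χ x ^ 2 * u x ^ 2
        + 2 * ∑ μ : Fin P.d, ∑ x : Site P j, (χ (x.shift μ) - χ x) ^ 2 * (u x + u (x.shift μ)) ^ 2 := by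
  have hc := caccioppoli_cutoff χ u
  -- replace `Δu` by `f` under `χ²`
  have hf : ∑ x : Site P j, χ x ^ 2 * u x * laplace 1 u x = ∑ x : Site P j, χ x ^ 2 * u x * f x := by
    refine Finset.sum_congr rfl fun x _ => ?_
    by_cases hx : χ x = 0
    · rw [hx]; ring
    · rw [hΔ x hx]
  rw [hf] at hc
  -- Young at scale `t`, pointwise
  have hy : 4 * ∑ x : Site P j, χ x ^ 2 * u x * f x ≤ 2 * t * ∑ x : Site P j, χ x ^ 2 * f x ^ 2 + 2 / t * ∑ x : Site P j, χ x ^ 2 * u x ^ 2 := by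
    rw [Finset.mul_sum, Finset.mul_sum, Finset.mul_sum, ← Finset.sum_add_distrib]
    refine Finset.sum_le_sum fun x _ => ?_
    have ht' : t ≠ 0 := ht.ne'
    have key : 0 ≤ t * (χ x * f x - χ x * u x / t) ^ 2 := mul_nonneg ht.le (sq_nonneg _)
    have expand : t * (χ x * f x - χ x * u x / t) ^ 2
        = t * (χ x ^ 2 * f x ^ 2) + 1 / t * (χ x ^ 2 * u x ^ 2) - 2 * (χ x ^ 2 * u x * f x) := by
      field_simp
      ring
    rw [expand] at key
    have : 4 * (χ x ^ 2 * u x * f x) ≤ 2 * t * (χ x ^ 2 * f x ^ 2) + 2 / t * (χ x ^ 2 * u x ^ 2) := by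
      have h2t : 2 / t * (χ x ^ 2 * u x ^ 2) = 2 * (1 / t * (χ x ^ 2 * u x ^ 2)) := by ring
      rw [h2t]
      linarith
    exact this
  linarith

/-- ★ **THE CONSUMER'S LEFT SIDE**: under the same hypotheses, `Σ_μΣ_x χ(x)²(u(x+e_μ) − u(x))² ≤ 2t·Σχ²f² + (2∕t)·Σχ²u² + 2·Σ_μΣ_x (χ(x+e_μ) − χ(x))²(u(x) + u(x+e_μ))²`
(drop the nonnegative `χ(x+e_μ)²`-weighted half). [cite: Giaquinta1984, Ch. III §2 (2.3)-(2.4) p.77] -/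
theorem sum_sq_mul_sq_diff_le_sourced (χ u f : SiteField P j ℝ) (hΔ : ∀ x : Site P j, χ x ≠ 0 → laplace 1 u x = f x) {t : ℝ} (ht : 0 < t) :
    ∑ μ : Fin P.d, ∑ x : Site P j, χ x ^ 2 * (u (x.shift μ) - u x) ^ 2
      ≤ 2 * t * ∑ x : Site P j, χ x ^ 2 * f x ^ 2 + 2 / t * ∑ x : Site P j, χ x ^ 2 * u x ^ 2
        + 2 * ∑ μ : Fin P.d, ∑ x : Site P j, (χ (x.shift μ) - χ x) ^ 2 * (u x + u (x.shift μ)) ^ 2 := by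
  have hc := caccioppoli_cutoff_sourced χ u f hΔ ht
  have hle : ∑ μ : Fin P.d, ∑ x : Site P j, χ x ^ 2 * (u (x.shift μ) - u x) ^ 2
      ≤ ∑ μ : Fin P.d, ∑ x : Site P j, (χ x ^ 2 + χ (x.shift μ) ^ 2) * (u (x.shift μ) - u x) ^ 2 := by
    refine Finset.sum_le_sum fun μ _ => Finset.sum_le_sum fun x _ => ?_
    have : 0 ≤ χ (x.shift μ) ^ 2 * (u (x.shift μ) - u x) ^ 2 := mul_nonneg (sq_nonneg _) (sq_nonneg _)
    nlinarith
  exact hle.trans hc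

end Summit.QuantumFields.YangMills.Theorems.Prop7FlatCutoffCaccioppoli

end
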